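import Literature.NumberTheory.LFunctions.DegreeOnePrimesPNT
import Literature.NumberTheory.LFunctions.NumberFieldDirichletDensity
import HarnessLib

/-!
# Mertens' theorems for the prime ideals of a number field (Landau 1903; Rosen 1999)

Topic `Literature/NumberTheory/LFunctions` (next to `PrimeIdealChebyshev.lean`,
`DegreeOnePrimesPNT.lean`). Everything in this file is PROVED (theorems only, no named facts).

For a number field `K` let `G(n) = #{𝔭 : N𝔭 = n}` (`normPrimeIdealCount K n`, Landau's `G(n)`) and
`θ_K(x) = ∑_{N𝔭 ≤ x} log N𝔭` (`chebyshevThetaIdeal K x`). From the tree's prime ideal theorem with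
de la Vallée-Poussin error term (`PrimeIdealTheoremProofs`, through
`abs_chebyshevPsiIdeal_sub_le` and `chebyshevThetaIdeal_sub_self_le`) we derive, by partial
summation, the number-field forms of Mertens' first and second theorems with bounded error and
the standard Euler-product majorants used "without further comment" in sieve arguments over
`𝓞_K` (e.g. Castillo–Hall–Lemke Oliver–Pollack–Thompson, arXiv:1403.5808, proof of Lemma 2.2,
citing Rosen 1999):

* `abs_chebyshevThetaIdeal_sub_self_le_logPow` — `|θ_K(x) − x| ≤ C x/(log x)^A` (`x ≥ 2`);
* `sum_primeIdealsLE_eq_sum_normPrimeIdealCount` — regrouping `∑_{N𝔭 ≤ x} f(N𝔭) = ∑_{n ≤ x} G(n) f(n)`;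
* **Mertens I** `abs_sum_log_div_absNorm_sub_log_le` — `|∑_{N𝔭 ≤ x} log N𝔭/N𝔭 − log x| ≤ C` (`x ≥ 2`);
* **Mertens II** `abs_sum_inv_absNorm_sub_loglog_le` — `|∑_{N𝔭 ≤ x} 1/N𝔭 − log log x| ≤ C` (`x ≥ 2`);
* `summable_inv_absNorm_sq` — `∑_𝔭 1/N𝔭²` converges;
* **Euler-product majorants** `prod_one_add_div_absNorm_le` — for `a ≥ 0`,
  `∏_{N𝔭 ≤ x} (1 + a/N𝔭) ≤ C_a (log x)^a`, and `prod_one_add_div_absNorm_sub_one_le` — the same for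
  `∏_{N𝔭 ≤ x} (1 + a/(N𝔭 − 1))` (`x ≥ 2`);
* `abs_sum_window_log_div_absNorm_sub_log_le` — Mertens I on windows `w < N𝔭 ≤ z` (hypothesis `(Ω₂)`
  of sieve lemmas); `idealCount_le_linear` — `I_K(x) ≤ C_K x`;
* `abs_sum_idealNormCount_div_sub_log_le` — the harmonic sum over all nonzero ideals,
  `∑_{0 < N𝔞 ≤ x} 1/N𝔞 = ρ_K log x + O_K(1)` (partial summation from the Weber–Landau ideal count);
* (namespace `EulerProductSums`, any index type) `sum_prod_le_prod_one_add`, `sum_prod_le_exp_tsum` —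
  partial sums of `S ↦ ∏_{v∈S} h(v)` over finite sets are `≤ ∏ (1 + h) ≤ exp(∑ h)` when `h ≥ 0` is
  summable (convergent Euler products `∏ (1 + h)`); the summability of `S ↦ ∏_{v∈S} h(v)` itself is
  Mathlib's `summable_finsetProd_of_summable_nonneg`.

The constants depend on `K` (and `a`); only `O(1)` forms are proved (Rosen's asymptotic constants
`log log x + B_K`, `e^{γ} ρ_K log x` are not needed for the sieve applications and not claimed).

## References

* E. Landau, *Neuer Beweis des Primzahlsatzes und Beweis des Primidealsatzes*, Math. Ann. 56 (1903),
  645–670, Part II, eq. (57) p. 669 (`θ_K(x) = x + O(x e^{−√log x /…})`) and `G(n)` (p. 669).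
  [LandauMathAnn1903]
* G. H. Hardy, E. M. Wright, *An Introduction to the Theory of Numbers*, 6th ed., OUP 2008, §22.5
  (22.5.2) (partial summation), §22.6 Theorems 424–425, §22.7 (22.7.3)–(22.7.4), Theorem 427 — the
  method, transposed verbatim from `ψ, ϑ` to `θ_K`. [HardyWright2008]
* M. Rosen, *A generalization of Mertens' theorem*, J. Ramanujan Math. Soc. 14 (1999), 1–19,
  Theorem 2 (`∏_{N𝔭 ≤ x}(1 − 1/N𝔭)^{−1} ∼ e^γ ρ_K log x`; the statements here are its `O(1)`
  weakenings and are proved independently). [Rosen1999Mertens]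

## Mathlib / tree search

Tree: `PrimeIdealChebyshev` (`normPrimeIdealCount`, `chebyshevThetaIdeal`, `finite_primeIdealsLE`,
`card_filter_primeIdealsLE_absNorm_eq`, `absNorm_mem_Icc_of_mem_primeIdealsLE`), `PrimeIdealPsi`
(`chebyshevThetaIdeal_sub_self_le`), `PrimeIdealTheoremProofs` (`abs_chebyshevPsiIdeal_sub_le`),
`DedekindZetaHalfPlaneProofs` (`exists_isLandauContinuation_of_idealCount`), `IdealCountProofs`
(`idealCount_sub_residue_mul_le_holds`), `PrimeNumberTheoremErrorTerm` (`logPow_of_expSqrt`),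
`NumberFieldDirichletDensity` (`summable_absNorm_rpow_neg`). Mathlib: `sum_mul_eq_sub_integral_mul₁`
(Abel summation), `Real.add_one_le_exp`, `Real.deriv_inv_log_apply`. No Mertens theorem over number
fields in Mathlib; the tree has the degree-one form with rate
(`sum_primesLE_idealNormCount_div_eq`) and the `ℚ(∛2)`-specific `HeathBrownCubicMertensK`.
-/

noncomputable section

open Finset Real MeasureTheory Filter
open scoped NumberField

namespace Literature.NumberTheory.LFunctions.NumberField

variable (K : Type*) [Field K] [NumberField K]

/-! ### `θ_K(x) = x + O(x/(log x)^A)` -/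

/-- The prime ideal theorem for `θ_K` in the `(log x)^{-A}` currency: for every real `A` there is
`C` with `|θ_K(x) − x| ≤ C x/(log x)^A` for all `x ≥ 2` (from the de la Vallée-Poussin form,
unconditionally, for every number field `K`). [cite: LandauMathAnn1903, eq. (57) p. 669] -/
theorem abs_chebyshevThetaIdeal_sub_self_le_logPow (A : ℝ) :
    ∃ C : ℝ, ∀ x : ℝ, 2 ≤ x → |chebyshevThetaIdeal K x - x| ≤ C * x / Real.log x ^ A := by
  obtain ⟨c, hc, C, hψ⟩ := abs_chebyshevPsiIdeal_sub_le K
    (exists_isLandauContinuation_of_idealCount K (idealCount_sub_residue_mul_le_holds K))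
  set C' : ℝ := C + 4 * Real.exp (1 / 8) * ((1 + C) * (1 / Real.log 2 + 1 / Real.log 2 ^ 2))
  have hθ : ∀ x : ℝ, 2 ≤ x → |chebyshevThetaIdeal K x - x| ≤
      C' * x / Real.exp (min c (1 / 8) * Real.sqrt (Real.log x)) := by
    intro x hx
    have h := chebyshevThetaIdeal_sub_self_le hc hψ hx
    rwa [neg_mul, Real.exp_neg, ← div_eq_mul_inv] at h
  exact logPow_of_expSqrt (lt_min hc (by norm_num)) hθ A

/-! ### Regrouping sums over prime ideals by the norm -/

variable {K} in
/-- `∑_{N𝔭 ≤ x} f(N𝔭) = ∑_{n ≤ x} G(n) f(n)` for any `f` (the fibres of the norm map on the prime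
ideals of norm `≤ x` have `G(n)` elements; Landau's `G(n)`, p. 669). [cite: LandauMathAnn1903, p. 669 (G(n))] -/
theorem sum_primeIdealsLE_eq_sum_normPrimeIdealCount (f : ℕ → ℝ) {x : ℝ} (hx : 0 ≤ x) :
    ∑ P ∈ (finite_primeIdealsLE K x).toFinset, f (Ideal.absNorm P) =
      ∑ n ∈ Icc 0 ⌊x⌋₊, (normPrimeIdealCount K n : ℝ) * f n := by
  classical
  rw [← sum_fiberwise_of_maps_to (g := fun P => Ideal.absNorm P) (t := Icc 0 ⌊x⌋₊)
    (s := (finite_primeIdealsLE K x).toFinset) fun P hP => absNorm_mem_Icc_of_mem_primeIdealsLE hP]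
  refine sum_congr rfl fun n hn => ?_
  have hnx : (n : ℝ) ≤ x := (Nat.le_floor_iff hx).mp (mem_Icc.mp hn).2
  rw [← card_filter_primeIdealsLE_absNorm_eq hnx,
    sum_congr rfl fun P hP => by rw [(mem_filter.mp hP).2], sum_const, nsmul_eq_mul]

/-- `G(n)`-weighted sums are step functions of `x` (they factor through `⌊x⌋₊`), hence
measurable. [folklore] -/
theorem measurable_sum_normPrimeIdealCount (f : ℕ → ℝ) :
    Measurable fun t : ℝ => ∑ n ∈ Icc 0 ⌊t⌋₊, (normPrimeIdealCount K n : ℝ) * f n := by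
  have : (fun t : ℝ => ∑ n ∈ Icc 0 ⌊t⌋₊, (normPrimeIdealCount K n : ℝ) * f n) =
      (fun m : ℕ => ∑ n ∈ Icc 0 m, (normPrimeIdealCount K n : ℝ) * f n) ∘ Nat.floor := by
    funext t; rfl
  rw [this]
  exact (measurable_from_nat (f := fun m : ℕ => ∑ n ∈ Icc 0 m,
    (normPrimeIdealCount K n : ℝ) * f n)).comp Nat.measurable_floor

end Literature.NumberTheory.LFunctions.NumberField

namespace Literature.NumberTheory.LFunctions.ThetaMertens

open Set

/-! ### Mertens I and II with bounded error from a Chebyshev estimate (abstract partial summation) -/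

/-- **Mertens' first theorem from a Chebyshev estimate** (partial summation (22.5.2) with
`f(t) = 1/t`, as in Hardy–Wright §22.6: `∑_{n ≤ x} c(n)/n = S(x)/x + ∫₂ˣ S(t) dt/t²`): if
`c : ℕ → ℝ` vanishes at `0, 1` and its summatory function `S(t) = ∑_{n ≤ t} c(n)` satisfies
`|S(t) − t| ≤ C t/(log t)²` for `t ≥ 2`, then `|∑_{n ≤ x} c(n)/n − log x| ≤ C'` for all `x ≥ 2`.
[cite: HardyWright2008, §22.6 (Theorem 424 and the display after Theorem 425)] -/
theorem abs_sum_div_sub_log_le {c : ℕ → ℝ} (hc0 : c 0 = 0) (hc1 : c 1 = 0) {C : ℝ}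
    (hmeas : Measurable fun t : ℝ => ∑ n ∈ Icc 0 ⌊t⌋₊, c n)
    (hS : ∀ t : ℝ, 2 ≤ t → |∑ n ∈ Icc 0 ⌊t⌋₊, c n - t| ≤ C * t / Real.log t ^ 2) :
    ∃ C' : ℝ, ∀ x : ℝ, 2 ≤ x → |∑ n ∈ Icc 0 ⌊x⌋₊, c n / n - Real.log x| ≤ C' := by
  set S : ℝ → ℝ := fun t => ∑ n ∈ Icc 0 ⌊t⌋₊, c n with hSdef
  have hl2 : 0 < Real.log 2 := Real.log_pos one_lt_two
  have hC : 0 ≤ C := by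
    have h := (abs_nonneg _).trans (hS 2 le_rfl)
    have h2 : (0 : ℝ) < 2 / Real.log 2 ^ 2 := by positivity
    have : C * 2 / Real.log 2 ^ 2 = C * (2 / Real.log 2 ^ 2) := by ring
    rw [this] at h
    nlinarith
  refine ⟨C / Real.log 2 ^ 2 + 1 + C / Real.log 2, fun x hx => ?_⟩
  have hx0 : 0 < x := by linarith
  have hlx : 0 < Real.log x := Real.log_pos (by linarith)
  have hl2x : Real.log 2 ≤ Real.log x := Real.log_le_log two_pos hx
  -- Abel summation with `f(t) = t⁻¹`
  set f : ℝ → ℝ := fun t => t⁻¹ with hf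
  have hf_diff : ∀ t ∈ Set.Icc 2 x, DifferentiableAt ℝ f t := fun t ht =>
    differentiableAt_inv (by linarith [ht.1])
  have hderiv_eq : ∀ t ∈ Set.Icc 2 x, deriv f t = -(t ^ 2)⁻¹ := fun t _ => deriv_inv
  have hcont : ContinuousOn (fun t : ℝ => -(t ^ 2)⁻¹) (Set.Icc 2 x) := by
    refine ContinuousOn.neg (ContinuousOn.inv₀ (continuousOn_id.pow 2) fun t ht => ?_)
    exact pow_ne_zero _ (by linarith [ht.1])
  have hf_int : IntegrableOn (deriv f) (Set.Icc 2 x) :=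
    hcont.integrableOn_Icc.congr_fun (fun t ht => (hderiv_eq t ht).symm) measurableSet_Icc
  have habel := sum_mul_eq_sub_integral_mul₁ c hc0 hc1 x hf_diff hf_int
  -- identify the left-hand side
  have hlhs : ∑ n ∈ Icc 0 ⌊x⌋₊, f n * c n = ∑ n ∈ Icc 0 ⌊x⌋₊, c n / n := by
    refine Finset.sum_congr rfl fun n _ => ?_
    simp only [hf]
    ring
  -- the integral: `∫ deriv f · S = -∫ S/t²`
  have hbound : ∀ t : ℝ, 2 ≤ t → |S t| ≤ (1 + C / Real.log 2 ^ 2) * t := by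
    intro t ht
    have ht0 : 0 < t := by linarith
    have hlt : Real.log 2 ≤ Real.log t := Real.log_le_log two_pos ht
    have h1 : |S t - t| ≤ C * t / Real.log t ^ 2 := hS t ht
    calc |S t| ≤ |S t - t| + |t| := by
          have := abs_sub_abs_le_abs_sub (S t) t; linarith
      _ ≤ C * t / Real.log t ^ 2 + t := by rw [abs_of_pos ht0]; linarith
      _ ≤ C * t / Real.log 2 ^ 2 + t := by gcongr
      _ = (1 + C / Real.log 2 ^ 2) * t := by ring
  have hint_S : IntegrableOn (fun t : ℝ => S t * (t ^ 2)⁻¹) (Set.Ioc 2 x) := by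
    have hconst : IntegrableOn (fun _ : ℝ => (1 + C / Real.log 2 ^ 2) / 2) (Set.Ioc 2 x) :=
      integrableOn_const (by simp)
    refine Integrable.mono' hconst ?_ ?_
    · exact (hmeas.mul ((measurable_id.pow_const 2).inv)).aestronglyMeasurable
    · rw [ae_restrict_iff' measurableSet_Ioc]
      refine Eventually.of_forall fun t ht => ?_
      have ht2 : 2 ≤ t := le_of_lt ht.1
      have ht0 : 0 < t := by linarith
      rw [Real.norm_eq_abs, abs_mul, abs_of_pos (by positivity : (0 : ℝ) < (t ^ 2)⁻¹)]
      calc |S t| * (t ^ 2)⁻¹ ≤ (1 + C / Real.log 2 ^ 2) * t * (t ^ 2)⁻¹ :=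
            mul_le_mul_of_nonneg_right (hbound t ht2) (by positivity)
        _ = (1 + C / Real.log 2 ^ 2) / t := by field_simp
        _ ≤ (1 + C / Real.log 2 ^ 2) / 2 := by gcongr
  have hint_eq : ∫ t in Set.Ioc 2 x, deriv f t * S t = -∫ t in Set.Ioc 2 x, S t * (t ^ 2)⁻¹ := by
    rw [← integral_neg]
    refine setIntegral_congr_fun measurableSet_Ioc fun t ht => ?_
    rw [hderiv_eq t (Set.Ioc_subset_Icc_self ht)]
    ring
  -- split `S(t)/t² = 1/t + (S(t) − t)/t²`
  have hint_inv : IntegrableOn (fun t : ℝ => t⁻¹) (Set.Ioc 2 x) := by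
    refine (continuousOn_inv₀.mono ?_).integrableOn_Icc.mono_set Set.Ioc_subset_Icc_self
    intro t ht
    exact Set.mem_compl_singleton_iff.mpr (show (0 : ℝ) < t by linarith [ht.1]).ne'
  have hint_E : IntegrableOn (fun t : ℝ => (S t - t) * (t ^ 2)⁻¹) (Set.Ioc 2 x) := by
    refine (hint_S.sub hint_inv).congr_fun (fun t ht => ?_) measurableSet_Ioc
    have ht0 : (t : ℝ) ≠ 0 := by linarith [ht.1]
    simp only [Pi.sub_apply]
    field_simp
  have hsplit : ∫ t in Set.Ioc 2 x, S t * (t ^ 2)⁻¹ =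
      (∫ t in Set.Ioc 2 x, t⁻¹) + ∫ t in Set.Ioc 2 x, (S t - t) * (t ^ 2)⁻¹ := by
    rw [← integral_add hint_inv hint_E]
    refine setIntegral_congr_fun measurableSet_Ioc fun t ht => ?_
    have ht0 : (t : ℝ) ≠ 0 := by linarith [ht.1]
    field_simp
    ring
  have hinv_val : ∫ t in Set.Ioc 2 x, t⁻¹ = Real.log x - Real.log 2 := by
    rw [← intervalIntegral.integral_of_le hx, integral_inv_of_pos two_pos hx0,
      Real.log_div hx0.ne' two_ne_zero]
  -- bound the error integral by `C/log 2`
  have hE_bound : |∫ t in Set.Ioc 2 x, (S t - t) * (t ^ 2)⁻¹| ≤ C / Real.log 2 := by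
    have hwint : IntegrableOn (fun t : ℝ => t⁻¹ / Real.log t ^ (0 + 2)) (Set.Ioc 2 x) :=
      (Literature.NumberTheory.LFunctions.Mertens.integrableOn_inv_div_log_pow one_lt_two 0).mono_set
        Set.Ioc_subset_Ioi_self
    have hb : ∀ᵐ t ∂(volume.restrict (Set.Ioc 2 x)),
        ‖(S t - t) * (t ^ 2)⁻¹‖ ≤ C * (t⁻¹ / Real.log t ^ (0 + 2)) := by
      rw [ae_restrict_iff' measurableSet_Ioc]
      refine Eventually.of_forall fun t ht => ?_
      have ht2 : 2 ≤ t := le_of_lt ht.1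
      have ht0 : 0 < t := by linarith
      rw [Real.norm_eq_abs, abs_mul, abs_of_pos (by positivity : (0 : ℝ) < (t ^ 2)⁻¹)]
      calc |S t - t| * (t ^ 2)⁻¹ ≤ C * t / Real.log t ^ 2 * (t ^ 2)⁻¹ :=
            mul_le_mul_of_nonneg_right (hS t ht2) (by positivity)
        _ = C * (t⁻¹ / Real.log t ^ (0 + 2)) := by field_simp
    calc |∫ t in Set.Ioc 2 x, (S t - t) * (t ^ 2)⁻¹|
        = ‖∫ t in Set.Ioc 2 x, (S t - t) * (t ^ 2)⁻¹‖ := rfl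
      _ ≤ ∫ t in Set.Ioc 2 x, C * (t⁻¹ / Real.log t ^ (0 + 2)) :=
          norm_integral_le_of_norm_le (hwint.const_mul C) hb
      _ ≤ ∫ t in Set.Ioi 2, C * (t⁻¹ / Real.log t ^ (0 + 2)) := by
          refine setIntegral_mono_set ((Literature.NumberTheory.LFunctions.Mertens.integrableOn_inv_div_log_pow
            one_lt_two 0).const_mul C) ?_ Set.Ioc_subset_Ioi_self.eventuallyLE
          rw [EventuallyLE, ae_restrict_iff' measurableSet_Ioi]
          refine Eventually.of_forall fun t ht => ?_
          have : 0 < Real.log t := Real.log_pos (by linarith [Set.mem_Ioi.1 ht])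
          have ht0 : 0 < t := by linarith [Set.mem_Ioi.1 ht]
          simp only [Pi.zero_apply]
          positivity
      _ = C / Real.log 2 := by
          rw [integral_const_mul,
            Literature.NumberTheory.LFunctions.Mertens.integral_Ioi_inv_div_log_pow one_lt_two 0,
            Nat.cast_zero, zero_add, one_mul, zero_add, pow_one, div_eq_mul_inv]
  -- the boundary term
  have hbdry : |f x * S x - 1| ≤ C / Real.log 2 ^ 2 := by
    have : f x * S x - 1 = (S x - x) * x⁻¹ := by
      simp only [hf]; field_simp
    rw [this, abs_mul, abs_of_pos (inv_pos.2 hx0)]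
    calc |S x - x| * x⁻¹ ≤ C * x / Real.log x ^ 2 * x⁻¹ :=
          mul_le_mul_of_nonneg_right (hS x hx) (by positivity)
      _ = C / Real.log x ^ 2 := by field_simp
      _ ≤ C / Real.log 2 ^ 2 := by gcongr
  -- assemble
  have hformula : ∑ n ∈ Icc 0 ⌊x⌋₊, c n / n - Real.log x =
      (f x * S x - 1) + (1 - Real.log 2) + ∫ t in Set.Ioc 2 x, (S t - t) * (t ^ 2)⁻¹ := by
    rw [← hlhs, habel, hint_eq, hsplit, hinv_val]
    simp only [hSdef]
    ring
  rw [hformula]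
  have hlog2 : |1 - Real.log 2| ≤ 1 := by
    rw [abs_le]
    constructor <;> linarith [Real.log_two_lt_d9]
  calc |(f x * S x - 1) + (1 - Real.log 2) + ∫ t in Set.Ioc 2 x, (S t - t) * (t ^ 2)⁻¹|
      ≤ |f x * S x - 1| + |1 - Real.log 2| + |∫ t in Set.Ioc 2 x, (S t - t) * (t ^ 2)⁻¹| :=
        abs_add_three _ _ _
    _ ≤ C / Real.log 2 ^ 2 + 1 + C / Real.log 2 :=
        add_le_add (add_le_add hbdry hlog2) hE_bound

/-- Functions of `⌊t⌋₊` are measurable (step functions). [folklore] -/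
theorem measurable_comp_natFloor (g : ℕ → ℝ) : Measurable fun t : ℝ => g ⌊t⌋₊ :=
  (measurable_from_nat (f := g)).comp Nat.measurable_floor

/-- **Mertens' second theorem from Mertens' first** (partial summation with `f(t) = 1/log t`,
Hardy–Wright (22.7.3)–(22.7.4): `∑ c(n)/(n log n) = C(x)/log x + ∫₂ˣ C(t) dt/(t log² t)`,
`C(t) = log t + τ(t)`, `τ = O(1)`): if `c : ℕ → ℝ` vanishes at `0, 1` and
`|∑_{n ≤ t} c(n)/n − log t| ≤ C₁` for `t ≥ 2`, then `|∑_{n ≤ x} c(n)/(n log n) − log log x| ≤ C'`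
for all `x ≥ 2` (the `O(1)` form of Theorem 427). [cite: HardyWright2008, §22.7 (22.7.3)–(22.7.4), Theorem 427] -/
theorem abs_sum_div_mul_log_sub_loglog_le {c : ℕ → ℝ} (hc0 : c 0 = 0) (hc1 : c 1 = 0) {C₁ : ℝ}
    (hT : ∀ t : ℝ, 2 ≤ t → |∑ n ∈ Icc 0 ⌊t⌋₊, c n / n - Real.log t| ≤ C₁) :
    ∃ C' : ℝ, ∀ x : ℝ, 2 ≤ x →
      |∑ n ∈ Icc 0 ⌊x⌋₊, c n / (n * Real.log n) - Real.log (Real.log x)| ≤ C' := by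
  set T : ℝ → ℝ := fun t => ∑ n ∈ Icc 0 ⌊t⌋₊, c n / n with hTdef
  have hTmeas : Measurable T := measurable_comp_natFloor fun m => ∑ n ∈ Icc 0 m, c n / n
  have hl2 : 0 < Real.log 2 := Real.log_pos one_lt_two
  have hC₁ : 0 ≤ C₁ := (abs_nonneg _).trans (hT 2 le_rfl)
  refine ⟨C₁ / Real.log 2 + 2 + C₁ / Real.log 2, fun x hx => ?_⟩
  have hx0 : 0 < x := by linarith
  have hlx : 0 < Real.log x := Real.log_pos (by linarith)
  have hl2x : Real.log 2 ≤ Real.log x := Real.log_le_log two_pos hx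
  -- Abel summation with `a(n) = c(n)/n`, `f(t) = (log t)⁻¹`
  set a : ℕ → ℝ := fun n => c n / n with ha
  have ha0 : a 0 = 0 := by simp [ha, hc0]
  have ha1 : a 1 = 0 := by simp [ha, hc1]
  set f : ℝ → ℝ := fun t => (Real.log t)⁻¹ with hf
  have hf_diff : ∀ t ∈ Set.Icc 2 x, DifferentiableAt ℝ f t := fun t ht =>
    Real.differentiableAt_inv_log (by linarith [ht.1]) (by linarith [ht.1]) (by linarith [ht.1])
  have hderiv_eq : ∀ t ∈ Set.Icc 2 x, deriv f t = -t⁻¹ / Real.log t ^ 2 := fun t _ =>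
    Real.deriv_inv_log_apply
  have hcont : ContinuousOn (fun t : ℝ => -t⁻¹ / Real.log t ^ 2) (Set.Icc 2 x) := by
    have h := (Literature.NumberTheory.LFunctions.Mertens.continuousOn_inv_div_log_pow x 2).neg
    refine h.congr fun t _ => ?_
    simp only [neg_div, Pi.neg_apply]
  have hf_int : IntegrableOn (deriv f) (Set.Icc 2 x) :=
    hcont.integrableOn_Icc.congr_fun (fun t ht => (hderiv_eq t ht).symm) measurableSet_Icc
  have habel := sum_mul_eq_sub_integral_mul₁ a ha0 ha1 x hf_diff hf_int
  have hlhs : ∑ n ∈ Icc 0 ⌊x⌋₊, f n * a n = ∑ n ∈ Icc 0 ⌊x⌋₊, c n / (n * Real.log n) := by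
    refine Finset.sum_congr rfl fun n _ => ?_
    simp only [hf, ha]
    rw [div_mul_eq_div_div, div_eq_mul_inv (c n / n), mul_comm]
  -- `T` is `log t + O(1)` on `[2, x]`
  have hTb : ∀ t : ℝ, 2 ≤ t → |T t| ≤ Real.log t + C₁ := by
    intro t ht
    have h1 : |T t - Real.log t| ≤ C₁ := hT t ht
    have hlt : 0 ≤ Real.log t := (Real.log_pos (by linarith)).le
    calc |T t| ≤ |T t - Real.log t| + |Real.log t| := by
          have := abs_sub_abs_le_abs_sub (T t) (Real.log t); linarith
      _ ≤ C₁ + Real.log t := add_le_add h1 (abs_of_nonneg hlt).le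
      _ = Real.log t + C₁ := add_comm _ _
  -- the weight `φ(t) = t⁻¹/log² t`
  have hφint : IntegrableOn (fun t : ℝ => t⁻¹ / Real.log t ^ (0 + 2)) (Set.Ioi 2) :=
    Literature.NumberTheory.LFunctions.Mertens.integrableOn_inv_div_log_pow one_lt_two 0
  have hint_T : IntegrableOn (fun t : ℝ => T t * (t⁻¹ / Real.log t ^ 2)) (Set.Ioc 2 x) := by
    have hconst : IntegrableOn (fun _ : ℝ => (Real.log x + C₁) * (2⁻¹ / Real.log 2 ^ 2))
        (Set.Ioc 2 x) := integrableOn_const (by simp)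
    refine Integrable.mono' hconst ?_ ?_
    · exact (hTmeas.mul (measurable_inv.div (Real.measurable_log.pow_const 2))).aestronglyMeasurable
    · rw [ae_restrict_iff' measurableSet_Ioc]
      refine Eventually.of_forall fun t ht => ?_
      have ht2 : 2 ≤ t := le_of_lt ht.1
      have ht0 : 0 < t := by linarith
      have hlt : Real.log 2 ≤ Real.log t := Real.log_le_log two_pos ht2
      have hl : 0 < Real.log t := hl2.trans_le hlt
      have hltx : Real.log t ≤ Real.log x := Real.log_le_log ht0 ht.2
      rw [Real.norm_eq_abs, abs_mul, abs_of_pos (by positivity : (0 : ℝ) < t⁻¹ / Real.log t ^ 2)]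
      calc |T t| * (t⁻¹ / Real.log t ^ 2) ≤ (Real.log t + C₁) * (t⁻¹ / Real.log t ^ 2) :=
            mul_le_mul_of_nonneg_right (hTb t ht2) (by positivity)
        _ ≤ (Real.log x + C₁) * (2⁻¹ / Real.log 2 ^ 2) := by
            gcongr
  have hint_eq : ∫ t in Set.Ioc 2 x, deriv f t * T t =
      -∫ t in Set.Ioc 2 x, T t * (t⁻¹ / Real.log t ^ 2) := by
    rw [← integral_neg]
    refine setIntegral_congr_fun measurableSet_Ioc fun t ht => ?_
    rw [hderiv_eq t (Set.Ioc_subset_Icc_self ht)]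
    ring
  -- split `T φ = t⁻¹/log t + (T − log t) φ`
  have hint_main : IntegrableOn (fun t : ℝ => t⁻¹ / Real.log t) (Set.Ioc 2 x) :=
    (Literature.NumberTheory.LFunctions.Mertens.continuousOn_inv_div_log x).integrableOn_Icc.mono_set
      Set.Ioc_subset_Icc_self
  have hint_E : IntegrableOn (fun t : ℝ => (T t - Real.log t) * (t⁻¹ / Real.log t ^ 2))
      (Set.Ioc 2 x) := by
    refine (hint_T.sub hint_main).congr_fun (fun t ht => ?_) measurableSet_Ioc
    have ht0 : (t : ℝ) ≠ 0 := by linarith [ht.1]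
    have hl : Real.log t ≠ 0 := (Real.log_pos (by linarith [ht.1])).ne'
    simp only [Pi.sub_apply]
    field_simp
  have hsplit : ∫ t in Set.Ioc 2 x, T t * (t⁻¹ / Real.log t ^ 2) =
      (∫ t in Set.Ioc 2 x, t⁻¹ / Real.log t) +
        ∫ t in Set.Ioc 2 x, (T t - Real.log t) * (t⁻¹ / Real.log t ^ 2) := by
    rw [← integral_add hint_main hint_E]
    refine setIntegral_congr_fun measurableSet_Ioc fun t ht => ?_
    have ht0 : (t : ℝ) ≠ 0 := by linarith [ht.1]
    have hl : Real.log t ≠ 0 := (Real.log_pos (by linarith [ht.1])).ne'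
    field_simp
    ring
  have hmain_val : ∫ t in Set.Ioc 2 x, t⁻¹ / Real.log t =
      Real.log (Real.log x) - Real.log (Real.log 2) := by
    rw [← intervalIntegral.integral_of_le hx]
    refine intervalIntegral.integral_eq_sub_of_hasDerivAt (f := fun t => Real.log (Real.log t))
      (fun t ht => ?_) ?_
    · rw [Set.uIcc_of_le hx] at ht
      exact Real.hasDerivAt_log_log (by linarith [ht.1]) (by linarith [ht.1]) (by linarith [ht.1])
    · exact ((Literature.NumberTheory.LFunctions.Mertens.continuousOn_inv_div_log x).mono
        (by rw [Set.uIcc_of_le hx])).intervalIntegrable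
  -- error integral `≤ C₁/log 2`
  have hE_bound : |∫ t in Set.Ioc 2 x, (T t - Real.log t) * (t⁻¹ / Real.log t ^ 2)| ≤
      C₁ / Real.log 2 := by
    have hb : ∀ᵐ t ∂(volume.restrict (Set.Ioc 2 x)),
        ‖(T t - Real.log t) * (t⁻¹ / Real.log t ^ 2)‖ ≤ C₁ * (t⁻¹ / Real.log t ^ (0 + 2)) := by
      rw [ae_restrict_iff' measurableSet_Ioc]
      refine Eventually.of_forall fun t ht => ?_
      have ht2 : 2 ≤ t := le_of_lt ht.1
      have ht0 : 0 < t := by linarith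
      have hl : 0 < Real.log t := Real.log_pos (by linarith)
      rw [Real.norm_eq_abs, abs_mul, abs_of_pos (by positivity : (0 : ℝ) < t⁻¹ / Real.log t ^ 2),
        zero_add]
      exact mul_le_mul_of_nonneg_right (hT t ht2) (by positivity)
    calc |∫ t in Set.Ioc 2 x, (T t - Real.log t) * (t⁻¹ / Real.log t ^ 2)|
        = ‖∫ t in Set.Ioc 2 x, (T t - Real.log t) * (t⁻¹ / Real.log t ^ 2)‖ := rfl
      _ ≤ ∫ t in Set.Ioc 2 x, C₁ * (t⁻¹ / Real.log t ^ (0 + 2)) :=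
          norm_integral_le_of_norm_le ((hφint.mono_set Set.Ioc_subset_Ioi_self).const_mul C₁) hb
      _ ≤ ∫ t in Set.Ioi 2, C₁ * (t⁻¹ / Real.log t ^ (0 + 2)) := by
          refine setIntegral_mono_set (hφint.const_mul C₁) ?_ Set.Ioc_subset_Ioi_self.eventuallyLE
          rw [EventuallyLE, ae_restrict_iff' measurableSet_Ioi]
          refine Eventually.of_forall fun t ht => ?_
          have : 0 < Real.log t := Real.log_pos (by linarith [Set.mem_Ioi.1 ht])
          have ht0 : 0 < t := by linarith [Set.mem_Ioi.1 ht]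
          simp only [Pi.zero_apply]
          positivity
      _ = C₁ / Real.log 2 := by
          rw [integral_const_mul,
            Literature.NumberTheory.LFunctions.Mertens.integral_Ioi_inv_div_log_pow one_lt_two 0,
            Nat.cast_zero, zero_add, one_mul, zero_add, pow_one, div_eq_mul_inv]
  -- boundary term `T(x)/log x = 1 + O(1/log x)`
  have hbdry : |f x * T x - 1| ≤ C₁ / Real.log 2 := by
    have : f x * T x - 1 = (T x - Real.log x) * (Real.log x)⁻¹ := by
      simp only [hf]; field_simp
    rw [this, abs_mul, abs_of_pos (inv_pos.2 hlx)]
    calc |T x - Real.log x| * (Real.log x)⁻¹ ≤ C₁ * (Real.log x)⁻¹ :=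
          mul_le_mul_of_nonneg_right (hT x hx) (by positivity)
      _ = C₁ / Real.log x := (div_eq_mul_inv _ _).symm
      _ ≤ C₁ / Real.log 2 := by gcongr
  -- `|log log 2| ≤ 1`
  have hll2 : |Real.log (Real.log 2)| ≤ 1 := by
    rw [abs_le]
    constructor
    · have h1 : Real.exp (-1) < Real.log 2 := by
        have := Real.exp_neg_one_lt_d9; have := Real.log_two_gt_d9; linarith
      have := Real.log_lt_log (Real.exp_pos _) h1
      rw [Real.log_exp] at this
      linarith
    · have : Real.log (Real.log 2) < 0 := Real.log_neg hl2 (by linarith [Real.log_two_lt_d9])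
      linarith
  have hformula : ∑ n ∈ Icc 0 ⌊x⌋₊, c n / (n * Real.log n) - Real.log (Real.log x) =
      (f x * T x - 1) + (1 - Real.log (Real.log 2)) +
        ∫ t in Set.Ioc 2 x, (T t - Real.log t) * (t⁻¹ / Real.log t ^ 2) := by
    rw [← hlhs, habel, hint_eq, hsplit, hmain_val]
    simp only [hTdef]
    ring
  rw [hformula]
  calc |(f x * T x - 1) + (1 - Real.log (Real.log 2)) +
        ∫ t in Set.Ioc 2 x, (T t - Real.log t) * (t⁻¹ / Real.log t ^ 2)|
      ≤ |f x * T x - 1| + |1 - Real.log (Real.log 2)| +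
          |∫ t in Set.Ioc 2 x, (T t - Real.log t) * (t⁻¹ / Real.log t ^ 2)| := abs_add_three _ _ _
    _ ≤ C₁ / Real.log 2 + (1 + 1) + C₁ / Real.log 2 := by
        refine add_le_add (add_le_add hbdry ?_) hE_bound
        calc |1 - Real.log (Real.log 2)| ≤ |(1 : ℝ)| + |Real.log (Real.log 2)| := abs_sub _ _
          _ ≤ 1 + 1 := by rw [abs_one]; exact add_le_add le_rfl hll2
    _ = C₁ / Real.log 2 + 2 + C₁ / Real.log 2 := by ring

end Literature.NumberTheory.LFunctions.ThetaMertens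

namespace Literature.NumberTheory.LFunctions.NumberField

variable (K : Type*) [Field K] [NumberField K]

/-! ### Mertens I and II for the prime ideals of `K` -/

/-- **Mertens' first theorem for `K`**, `n`-sum form: `|∑_{n ≤ x} G(n) log n / n − log x| ≤ C_K`
for all `x ≥ 2` — Hardy–Wright's partial summation for Theorem 424 run on Landau's `θ_K`
(`θ_K(x) = x + O(x e^{−c√log x})`, (57) p. 669) in place of `ψ`.
[cite: LandauMathAnn1903, eq. (57) p. 669] [cite: HardyWright2008, §22.6 Theorem 424 (method)] -/
theorem abs_sum_normPrimeIdealCount_mul_log_div_sub_log_le :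
    ∃ C : ℝ, ∀ x : ℝ, 2 ≤ x →
      |∑ n ∈ Icc 0 ⌊x⌋₊, (normPrimeIdealCount K n : ℝ) * Real.log n / n - Real.log x| ≤ C := by
  obtain ⟨C, hC⟩ := abs_chebyshevThetaIdeal_sub_self_le_logPow K 2
  have hS : ∀ t : ℝ, 2 ≤ t → |∑ n ∈ Icc 0 ⌊t⌋₊, (normPrimeIdealCount K n : ℝ) * Real.log n - t| ≤
      C * t / Real.log t ^ 2 := by
    intro t ht
    have := hC t ht
    rwa [Real.rpow_two] at this
  exact ThetaMertens.abs_sum_div_sub_log_le (c := fun n => (normPrimeIdealCount K n : ℝ) * Real.log n)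
    (by simp) (by simp) (measurable_sum_normPrimeIdealCount K fun n => Real.log n) hS

/-- **Mertens' first theorem for `K`**, prime-ideal form: `|∑_{N𝔭 ≤ x} log N𝔭 / N𝔭 − log x| ≤ C_K`
for all `x ≥ 2`. [cite: LandauMathAnn1903, eq. (57) p. 669] [cite: HardyWright2008, §22.6 Theorem 425 (method)] -/
theorem abs_sum_log_div_absNorm_sub_log_le :
    ∃ C : ℝ, ∀ x : ℝ, 2 ≤ x →
      |∑ P ∈ (finite_primeIdealsLE K x).toFinset,
          Real.log (Ideal.absNorm P) / (Ideal.absNorm P : ℝ) - Real.log x| ≤ C := by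
  obtain ⟨C, hC⟩ := abs_sum_normPrimeIdealCount_mul_log_div_sub_log_le K
  refine ⟨C, fun x hx => ?_⟩
  rw [sum_primeIdealsLE_eq_sum_normPrimeIdealCount (f := fun n => Real.log n / n) (by linarith)]
  simpa only [mul_div_assoc] using hC x hx

/-- **Mertens' second theorem for `K`**, `n`-sum form: `|∑_{n ≤ x} G(n)/n − log log x| ≤ C_K` for
all `x ≥ 2` (the `O(1)` weakening of Rosen's generalization of Mertens' theorem,
`∏_{N𝔭 ≤ x}(1 − 1/N𝔭)^{−1} ∼ e^γ ρ_K log x`, obtained here directly by Hardy–Wright's partial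
summation (22.7.3) from Mertens I for `K`).
[cite: Rosen1999Mertens, Theorem 2 (O(1) consequence)] [cite: HardyWright2008, §22.7 Theorem 427 (method)] -/
theorem abs_sum_normPrimeIdealCount_div_sub_loglog_le :
    ∃ C : ℝ, ∀ x : ℝ, 2 ≤ x →
      |∑ n ∈ Icc 0 ⌊x⌋₊, (normPrimeIdealCount K n : ℝ) / n - Real.log (Real.log x)| ≤ C := by
  obtain ⟨C₁, hC₁⟩ := abs_sum_normPrimeIdealCount_mul_log_div_sub_log_le K
  obtain ⟨C, hC⟩ := ThetaMertens.abs_sum_div_mul_log_sub_loglog_le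
    (c := fun n => (normPrimeIdealCount K n : ℝ) * Real.log n) (by simp) (by simp) hC₁
  refine ⟨C, fun x hx => ?_⟩
  convert hC x hx using 3
  refine Finset.sum_congr rfl fun n _ => ?_
  rcases Nat.lt_or_ge n 2 with hn | hn
  · interval_cases n <;> simp
  · have hn0 : (n : ℝ) ≠ 0 := by positivity
    have hlog : Real.log n ≠ 0 :=
      Real.log_ne_zero_of_pos_of_ne_one (by positivity) (by exact_mod_cast (by omega : n ≠ 1))
    field_simp

/-- **Mertens' second theorem for `K`**, prime-ideal form: `|∑_{N𝔭 ≤ x} 1/N𝔭 − log log x| ≤ C_K`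
for all `x ≥ 2`. [cite: Rosen1999Mertens, Theorem 2 (O(1) consequence)] -/
theorem abs_sum_inv_absNorm_sub_loglog_le :
    ∃ C : ℝ, ∀ x : ℝ, 2 ≤ x →
      |∑ P ∈ (finite_primeIdealsLE K x).toFinset, (Ideal.absNorm P : ℝ)⁻¹ -
          Real.log (Real.log x)| ≤ C := by
  obtain ⟨C, hC⟩ := abs_sum_normPrimeIdealCount_div_sub_loglog_le K
  refine ⟨C, fun x hx => ?_⟩
  rw [sum_primeIdealsLE_eq_sum_normPrimeIdealCount (f := fun n => (n : ℝ)⁻¹) (by linarith)]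
  simpa only [div_eq_mul_inv] using hC x hx

/-- Upper bound form of Mertens II: `∑_{N𝔭 ≤ x} 1/N𝔭 ≤ log log x + C_K` (`x ≥ 2`).
[cite: Rosen1999Mertens, Theorem 2 (O(1) consequence)] -/
theorem sum_inv_absNorm_le_loglog_add :
    ∃ C : ℝ, ∀ x : ℝ, 2 ≤ x →
      ∑ P ∈ (finite_primeIdealsLE K x).toFinset, (Ideal.absNorm P : ℝ)⁻¹ ≤
        Real.log (Real.log x) + C := by
  obtain ⟨C, hC⟩ := abs_sum_inv_absNorm_sub_loglog_le K
  exact ⟨C, fun x hx => by have := (abs_le.1 (hC x hx)).2; linarith⟩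

/-! ### Convergent sums over prime ideals -/

/-- `∑_𝔭 1/N𝔭²` converges (dominated by `ζ_K(2)`). [folklore] -/
theorem summable_inv_absNorm_sq :
    Summable fun v : IsDedekindDomain.HeightOneSpectrum (𝓞 K) =>
      ((Ideal.absNorm v.asIdeal : ℝ) ^ 2)⁻¹ := by
  refine (summable_absNorm_rpow_neg (K := K) one_lt_two).congr fun v => ?_
  rw [Real.rpow_neg (Nat.cast_nonneg _), Real.rpow_two]

/-- `1/(N𝔭(N𝔭 − 1)) ≤ 2/N𝔭²` since `N𝔭 ≥ 2`; hence `∑_𝔭 a/(N𝔭(N𝔭−1))` converges. [folklore] -/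
theorem summable_div_absNorm_mul_absNorm_sub_one (a : ℝ) :
    Summable fun v : IsDedekindDomain.HeightOneSpectrum (𝓞 K) =>
      a / ((Ideal.absNorm v.asIdeal : ℝ) * ((Ideal.absNorm v.asIdeal : ℝ) - 1)) := by
  have h2 : ∀ v : IsDedekindDomain.HeightOneSpectrum (𝓞 K), (2 : ℝ) ≤ Ideal.absNorm v.asIdeal := by
    intro v
    have := one_lt_absNorm (K := K) v
    exact_mod_cast Nat.succ_le_of_lt (by exact_mod_cast this)
  have hbase : Summable fun v : IsDedekindDomain.HeightOneSpectrum (𝓞 K) =>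
      1 / ((Ideal.absNorm v.asIdeal : ℝ) * ((Ideal.absNorm v.asIdeal : ℝ) - 1)) := by
    refine ((summable_inv_absNorm_sq K).mul_left 2).of_nonneg_of_le (fun v => ?_) (fun v => ?_)
    · have := h2 v
      have h1 : (0 : ℝ) < (Ideal.absNorm v.asIdeal : ℝ) - 1 := by linarith
      positivity
    · have hN := h2 v
      rw [div_le_iff₀ (by nlinarith), mul_comm]
      have : (Ideal.absNorm v.asIdeal : ℝ) ^ 2 ≤
          2 * ((Ideal.absNorm v.asIdeal : ℝ) * ((Ideal.absNorm v.asIdeal : ℝ) - 1)) := by nlinarith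
      calc (Ideal.absNorm v.asIdeal : ℝ) * ((Ideal.absNorm v.asIdeal : ℝ) - 1) *
            (2 * ((Ideal.absNorm v.asIdeal : ℝ) ^ 2)⁻¹)
          = 2 * ((Ideal.absNorm v.asIdeal : ℝ) * ((Ideal.absNorm v.asIdeal : ℝ) - 1)) /
              (Ideal.absNorm v.asIdeal : ℝ) ^ 2 := by ring
        _ ≥ (Ideal.absNorm v.asIdeal : ℝ) ^ 2 / (Ideal.absNorm v.asIdeal : ℝ) ^ 2 := by gcongr
        _ = 1 := div_self (by positivity)
  simpa only [div_eq_mul_one_div a] using hbase.mul_left a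

end Literature.NumberTheory.LFunctions.NumberField

namespace Literature.NumberTheory.LFunctions.NumberField

variable (K : Type*) [Field K] [NumberField K]

/-! ### From finite sums over `N𝔭 ≤ x` to sums over all primes -/

variable {K} in
/-- A finite sum of a nonnegative summable function over the prime ideals of norm `≤ x` is bounded
by the full sum over all nonzero primes. [folklore] -/
theorem sum_primeIdealsLE_le_tsum {g : Ideal (𝓞 K) → ℝ} (hg0 : ∀ P, 0 ≤ g P)
    (hg : Summable fun v : IsDedekindDomain.HeightOneSpectrum (𝓞 K) => g v.asIdeal) (x : ℝ) :
    ∑ P ∈ (finite_primeIdealsLE K x).toFinset, g P ≤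
      ∑' v : IsDedekindDomain.HeightOneSpectrum (𝓞 K), g v.asIdeal := by
  classical
  set T := (finite_primeIdealsLE K x).toFinset with hT
  have hinj : Set.InjOn (fun v : IsDedekindDomain.HeightOneSpectrum (𝓞 K) => v.asIdeal)
      ((fun v : IsDedekindDomain.HeightOneSpectrum (𝓞 K) => v.asIdeal) ⁻¹' ↑T) :=
    fun v _ w _ h => IsDedekindDomain.HeightOneSpectrum.ext h
  rw [← Finset.sum_preimage (fun v : IsDedekindDomain.HeightOneSpectrum (𝓞 K) => v.asIdeal) T hinj g
    (fun P hP hnot => ?_)]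
  · exact hg.sum_le_tsum _ fun v _ => hg0 _
  · exfalso
    rw [hT, Set.Finite.mem_toFinset] at hP
    exact hnot ⟨⟨P, hP.1, hP.2.1⟩, rfl⟩

/-! ### Euler-product majorants -/

variable {K} in
/-- `2 ≤ N𝔭` for a prime ideal of norm `≤ x` (these are nonzero primes). [folklore] -/
theorem two_le_absNorm_of_mem_primeIdealsLE {x : ℝ} {P : Ideal (𝓞 K)}
    (hP : P ∈ (finite_primeIdealsLE K x).toFinset) : (2 : ℝ) ≤ Ideal.absNorm P := by
  rw [Set.Finite.mem_toFinset] at hP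
  have h := one_lt_absNorm (K := K) ⟨P, hP.1, hP.2.1⟩
  exact_mod_cast Nat.succ_le_of_lt (by exact_mod_cast h)

/-- **Euler-product majorant** ("estimation of sums by Euler products", via Mertens II): for
`a ≥ 0` there is `C` with `∏_{N𝔭 ≤ x} (1 + a/N𝔭) ≤ C (log x)^a` for all `x ≥ 2`
(`1 + y ≤ e^y` and `∑_{N𝔭 ≤ x} 1/N𝔭 ≤ log log x + C_K`). [cite: Rosen1999Mertens, Theorem 2 (consequence)] -/
theorem prod_one_add_div_absNorm_le {a : ℝ} (ha : 0 ≤ a) :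
    ∃ C : ℝ, ∀ x : ℝ, 2 ≤ x →
      ∏ P ∈ (finite_primeIdealsLE K x).toFinset, (1 + a / (Ideal.absNorm P : ℝ)) ≤
        C * Real.log x ^ a := by
  obtain ⟨C₂, hC₂⟩ := sum_inv_absNorm_le_loglog_add K
  refine ⟨Real.exp (a * C₂), fun x hx => ?_⟩
  have hlx : 0 < Real.log x := Real.log_pos (by linarith)
  calc ∏ P ∈ (finite_primeIdealsLE K x).toFinset, (1 + a / (Ideal.absNorm P : ℝ))
      ≤ ∏ P ∈ (finite_primeIdealsLE K x).toFinset, Real.exp (a / (Ideal.absNorm P : ℝ)) := by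
        refine Finset.prod_le_prod (fun P _ => by positivity) fun P _ => ?_
        have := Real.add_one_le_exp (a / (Ideal.absNorm P : ℝ))
        linarith
    _ = Real.exp (a * ∑ P ∈ (finite_primeIdealsLE K x).toFinset, (Ideal.absNorm P : ℝ)⁻¹) := by
        rw [← Real.exp_sum, Finset.mul_sum]
        simp_rw [div_eq_mul_inv]
    _ ≤ Real.exp (a * (Real.log (Real.log x) + C₂)) := by
        gcongr
        exact hC₂ x hx
    _ = Real.exp (a * C₂) * Real.log x ^ a := by
        rw [mul_add, Real.exp_add, Real.rpow_def_of_pos hlx, mul_comm (Real.log (Real.log x)) a]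
        ring

/-- **Euler-product majorant with `N𝔭 − 1`** (the shape `∏ (1 + k/(N𝔭 − 1))`, `φ(𝔭) = N𝔭 − 1`, of
the sieve bounds for `∑ μ²(𝔲)/φ(𝔲)` and its powers): for `a ≥ 0` there is `C` with
`∏_{N𝔭 ≤ x} (1 + a/(N𝔭 − 1)) ≤ C (log x)^a` for all `x ≥ 2` (compare with `1 + a/N𝔭` up to the
convergent `∏ (1 + a/(N𝔭(N𝔭−1)))`). [cite: Rosen1999Mertens, Theorem 2 (consequence)] -/
theorem prod_one_add_div_absNorm_sub_one_le {a : ℝ} (ha : 0 ≤ a) :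
    ∃ C : ℝ, ∀ x : ℝ, 2 ≤ x →
      ∏ P ∈ (finite_primeIdealsLE K x).toFinset, (1 + a / ((Ideal.absNorm P : ℝ) - 1)) ≤
        C * Real.log x ^ a := by
  obtain ⟨C₁, hC₁⟩ := prod_one_add_div_absNorm_le K ha
  set S : ℝ := ∑' v : IsDedekindDomain.HeightOneSpectrum (𝓞 K),
    a / ((Ideal.absNorm v.asIdeal : ℝ) * ((Ideal.absNorm v.asIdeal : ℝ) - 1)) with hSdef
  refine ⟨C₁ * Real.exp S, fun x hx => ?_⟩
  have hlx : 0 < Real.log x := Real.log_pos (by linarith)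
  set T := (finite_primeIdealsLE K x).toFinset with hT
  have hstep : ∀ P ∈ T, 1 + a / ((Ideal.absNorm P : ℝ) - 1) ≤
      (1 + a / (Ideal.absNorm P : ℝ)) *
        Real.exp (a / ((Ideal.absNorm P : ℝ) * ((Ideal.absNorm P : ℝ) - 1))) := by
    intro P hP
    have hN := two_le_absNorm_of_mem_primeIdealsLE hP
    set N : ℝ := (Ideal.absNorm P : ℝ) with hNdef
    have hN1 : 0 < N - 1 := by linarith
    have hN0 : 0 < N := by linarith
    have hid : 1 + a / (N - 1) = 1 + a / N + a / (N * (N - 1)) := by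
      field_simp
      ring
    have h1 : 1 + a / N + a / (N * (N - 1)) ≤ (1 + a / N) * (1 + a / (N * (N - 1))) := by
      have : 0 ≤ a / N * (a / (N * (N - 1))) := by positivity
      nlinarith
    have h2 : (1 + a / N) * (1 + a / (N * (N - 1))) ≤
        (1 + a / N) * Real.exp (a / (N * (N - 1))) := by
      refine mul_le_mul_of_nonneg_left ?_ (by positivity)
      have := Real.add_one_le_exp (a / (N * (N - 1)))
      linarith
    linarith
  have hprod_nonneg : ∀ P ∈ T, 0 ≤ 1 + a / ((Ideal.absNorm P : ℝ) - 1) := by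
    intro P hP
    have hN := two_le_absNorm_of_mem_primeIdealsLE hP
    have : 0 < (Ideal.absNorm P : ℝ) - 1 := by linarith
    positivity
  calc ∏ P ∈ T, (1 + a / ((Ideal.absNorm P : ℝ) - 1))
      ≤ ∏ P ∈ T, ((1 + a / (Ideal.absNorm P : ℝ)) *
          Real.exp (a / ((Ideal.absNorm P : ℝ) * ((Ideal.absNorm P : ℝ) - 1)))) :=
        Finset.prod_le_prod hprod_nonneg hstep
    _ = (∏ P ∈ T, (1 + a / (Ideal.absNorm P : ℝ))) *
          Real.exp (∑ P ∈ T, a / ((Ideal.absNorm P : ℝ) * ((Ideal.absNorm P : ℝ) - 1))) := by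
        rw [Finset.prod_mul_distrib, Real.exp_sum]
    _ ≤ (C₁ * Real.log x ^ a) * Real.exp S := by
        have hle : ∑ P ∈ T, a / ((Ideal.absNorm P : ℝ) * ((Ideal.absNorm P : ℝ) - 1)) ≤ S := by
          refine sum_primeIdealsLE_le_tsum (g := fun P : Ideal (𝓞 K) =>
            a / ((Ideal.absNorm P : ℝ) * ((Ideal.absNorm P : ℝ) - 1))) (fun P => ?_)
            (summable_div_absNorm_mul_absNorm_sub_one K a) x
          -- nonnegativity for every ideal (for `N P ≤ 1` the denominator is `≤ 0`, value `≤ 0`?):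
          -- we use instead that the denominator `N(N-1) ≥ 0` for every natural number `N`
          have hN : (0 : ℝ) ≤ (Ideal.absNorm P : ℝ) * ((Ideal.absNorm P : ℝ) - 1) := by
            rcases Nat.eq_zero_or_pos (Ideal.absNorm P) with h | h
            · simp [h]
            · have : (1 : ℝ) ≤ Ideal.absNorm P := by exact_mod_cast h
              exact mul_nonneg (by linarith) (by linarith)
          exact div_nonneg ha hN
        have hp0 : 0 ≤ ∏ P ∈ T, (1 + a / (Ideal.absNorm P : ℝ)) :=
          Finset.prod_nonneg fun P _ => by positivity
        exact mul_le_mul (hC₁ x hx) (Real.exp_le_exp.2 hle) (Real.exp_pos _).le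
          ((hp0.trans (hC₁ x hx)))
    _ = C₁ * Real.exp S * Real.log x ^ a := by ring

end Literature.NumberTheory.LFunctions.NumberField

namespace Literature.NumberTheory.LFunctions.NumberField

variable (K : Type*) [Field K] [NumberField K]

/-! ### Windows `w < N𝔭 ≤ z` and the linear ideal-count bound -/

/-- **Mertens I on windows** (the shape of hypothesis `(Ω₂)` of Halberstam–Richert / of Lemma 2.5 of
Castillo et al. for `γ ≡ 1`): `|∑_{w < N𝔭 ≤ z} log N𝔭/N𝔭 − log(z/w)| ≤ C_K` for `2 ≤ w ≤ z`.
[cite: LandauMathAnn1903, eq. (57) p. 669] [cite: HardyWright2008, §22.6 Theorem 425 (method)] -/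
theorem abs_sum_window_log_div_absNorm_sub_log_le :
    ∃ C : ℝ, ∀ w z : ℝ, 2 ≤ w → w ≤ z →
      |∑ n ∈ Ioc ⌊w⌋₊ ⌊z⌋₊, (normPrimeIdealCount K n : ℝ) * Real.log n / n -
          Real.log (z / w)| ≤ C := by
  obtain ⟨C, hC⟩ := abs_sum_normPrimeIdealCount_mul_log_div_sub_log_le K
  refine ⟨C + C, fun w z hw hwz => ?_⟩
  have hz := hC z (hw.trans hwz)
  have hw' := hC w hw
  have hsplit : ∑ n ∈ Ioc ⌊w⌋₊ ⌊z⌋₊, (normPrimeIdealCount K n : ℝ) * Real.log n / n =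
      ∑ n ∈ Icc 0 ⌊z⌋₊, (normPrimeIdealCount K n : ℝ) * Real.log n / n -
        ∑ n ∈ Icc 0 ⌊w⌋₊, (normPrimeIdealCount K n : ℝ) * Real.log n / n := by
    rw [eq_sub_iff_add_eq, add_comm, ← Finset.sum_union]
    · congr 1
      ext n
      simp only [Finset.mem_union, Finset.mem_Icc, Finset.mem_Ioc]
      have := Nat.floor_le_floor hwz
      omega
    · rw [Finset.disjoint_left]
      intro n hn hn'
      simp only [Finset.mem_Icc, Finset.mem_Ioc] at hn hn'
      omega
  rw [hsplit, Real.log_div (by linarith) (by linarith)]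
  calc _ = |(∑ n ∈ Icc 0 ⌊z⌋₊, (normPrimeIdealCount K n : ℝ) * Real.log n / n - Real.log z) -
        (∑ n ∈ Icc 0 ⌊w⌋₊, (normPrimeIdealCount K n : ℝ) * Real.log n / n - Real.log w)| := by
          ring_nf
    _ ≤ _ := abs_sub _ _
    _ ≤ C + C := add_le_add hz hw'

/-- **Linear bound for the ideal count**: `I_K(x) ≤ C_K x` for `x ≥ 1` (from the Weber–Landau count
`I_K(x) = ρ_K x + O(x^{1−1/d})`, proved in the tree). [cite: MontgomeryVaughan2007, (8.43) p. 266] -/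
theorem idealCount_le_linear :
    ∃ C : ℝ, ∀ x : ℝ, 1 ≤ x → (idealCount K x : ℝ) ≤ C * x := by
  obtain ⟨C, hC⟩ := idealCount_sub_residue_mul_le_holds K
  refine ⟨NumberField.dedekindZeta_residue K + |C|, fun x hx => ?_⟩
  have hx0 : 0 < x := by linarith
  have h := (abs_le.1 (hC x hx)).2
  have hpow : x ^ (1 - 1 / (Module.finrank ℚ K : ℝ)) ≤ x := by
    calc x ^ (1 - 1 / (Module.finrank ℚ K : ℝ)) ≤ x ^ (1 : ℝ) :=
          Real.rpow_le_rpow_of_exponent_le hx (by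
            have : (0 : ℝ) < Module.finrank ℚ K := by exact_mod_cast Module.finrank_pos
            linarith [one_div_pos.2 this])
      _ = x := Real.rpow_one x
  have hCx : C * x ^ (1 - 1 / (Module.finrank ℚ K : ℝ)) ≤ |C| * x := by
    calc C * x ^ (1 - 1 / (Module.finrank ℚ K : ℝ)) ≤ |C| * x ^ (1 - 1 / (Module.finrank ℚ K : ℝ)) :=
          mul_le_mul_of_nonneg_right (le_abs_self C) (by positivity)
      _ ≤ |C| * x := mul_le_mul_of_nonneg_left hpow (abs_nonneg C)
  linarith

end Literature.NumberTheory.LFunctions.NumberField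

namespace Literature.NumberTheory.LFunctions.EulerProductSums

/-! ### Summability of `S ↦ ∏_{v ∈ S} h(v)` over finite sets (squarefree Euler products) -/

/-- Partial sums of `∏_{v ∈ S} h(v)` over a finite family of finite sets are bounded by the Euler
product over the union: `∑_{S ∈ F} ∏_{v∈S} h(v) ≤ ∏_{v ∈ ⋃F} (1 + h(v))` (`h ≥ 0`). [folklore] -/
theorem sum_prod_le_prod_one_add {ι : Type*} [DecidableEq ι] {h : ι → ℝ} (hh : ∀ v, 0 ≤ h v)
    (F : Finset (Finset ι)) : ∑ S ∈ F, ∏ v ∈ S, h v ≤ ∏ v ∈ F.sup id, (1 + h v) := by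
  rw [Finset.prod_one_add]
  refine Finset.sum_le_sum_of_subset_of_nonneg (fun S hS => ?_) fun S _ _ =>
    Finset.prod_nonneg fun v _ => hh v
  exact Finset.mem_powerset.2 (Finset.le_sup (f := id) hS)

/-- **Convergent Euler products bound squarefree sums**: if `h ≥ 0` is summable, every partial sum
of `S ↦ ∏_{v ∈ S} h(v)` over finite sets satisfies `∑_{S ∈ F} ∏_{v∈S} h(v) ≤ exp(∑' h)` (the shape
of `∑_𝔰 μ²(𝔰)/φ(𝔰)² ≤ ∏_𝔭 (1 + 1/(N𝔭−1)²) < ∞` used in the proofs of Lemmas 2.2–2.3 of Castillo et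
al.); the summability of `S ↦ ∏_{v ∈ S} h(v)` itself is Mathlib's
`summable_finsetProd_of_summable_nonneg`. [folklore] -/
theorem sum_prod_le_exp_tsum {ι : Type*} {h : ι → ℝ} (hh : ∀ v, 0 ≤ h v) (hs : Summable h)
    (F : Finset (Finset ι)) : ∑ S ∈ F, ∏ v ∈ S, h v ≤ Real.exp (∑' v, h v) := by
  classical
  calc ∑ S ∈ F, ∏ v ∈ S, h v ≤ ∏ v ∈ F.sup id, (1 + h v) := sum_prod_le_prod_one_add hh F
    _ ≤ ∏ v ∈ F.sup id, Real.exp (h v) :=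
        Finset.prod_le_prod (fun v _ => by linarith [hh v]) fun v _ => by
          linarith [Real.add_one_le_exp (h v)]
    _ = Real.exp (∑ v ∈ F.sup id, h v) := (Real.exp_sum _ _).symm
    _ ≤ Real.exp (∑' v, h v) := Real.exp_le_exp.2 (hs.sum_le_tsum _ fun v _ => hh v)

end Literature.NumberTheory.LFunctions.EulerProductSums

namespace Literature.NumberTheory.LFunctions.NumberField

variable (K : Type*) [Field K] [NumberField K]

/-! ### The harmonic sum over all nonzero ideals -/

omit [NumberField K] in
/-- `x^{1−1/d} (log x)² ≤ 4d² x` for `x ≥ 1` (from `log x ≤ x^{ε}/ε` with `ε = 1/(2d)`). [folklore] -/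
theorem rpow_one_sub_inv_mul_log_sq_le {d : ℕ} (hd : 0 < d) {x : ℝ} (hx : 1 ≤ x) :
    x ^ (1 - 1 / (d : ℝ)) * Real.log x ^ 2 ≤ 4 * (d : ℝ) ^ 2 * x := by
  have hx0 : 0 < x := by linarith
  have hdR : (0 : ℝ) < d := by exact_mod_cast hd
  set ε : ℝ := 1 / (2 * d) with hε
  have hε0 : 0 < ε := by positivity
  have hlog : Real.log x ≤ x ^ ε / ε := Real.log_le_rpow_div hx0.le hε0
  have hlog0 : 0 ≤ Real.log x := Real.log_nonneg hx
  have hsq : Real.log x ^ 2 ≤ (x ^ ε / ε) ^ 2 := pow_le_pow_left₀ hlog0 hlog 2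
  have hrpow : (x ^ ε) ^ 2 = x ^ (1 / (d : ℝ)) := by
    rw [← Real.rpow_natCast, ← Real.rpow_mul hx0.le, hε]
    congr 1
    push_cast
    field_simp
  have hεsq : ε ^ 2 = 1 / (4 * (d : ℝ) ^ 2) := by rw [hε]; field_simp; ring
  calc x ^ (1 - 1 / (d : ℝ)) * Real.log x ^ 2 ≤ x ^ (1 - 1 / (d : ℝ)) * (x ^ ε / ε) ^ 2 :=
        mul_le_mul_of_nonneg_left hsq (by positivity)
    _ = x ^ (1 - 1 / (d : ℝ)) * x ^ (1 / (d : ℝ)) * (4 * (d : ℝ) ^ 2) := by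
        rw [div_pow, hrpow, hεsq]; field_simp
    _ = 4 * (d : ℝ) ^ 2 * x := by
        rw [← Real.rpow_add hx0, sub_add_cancel, Real.rpow_one]; ring

/-- **The harmonic sum over the nonzero ideals of `𝓞_K`**: with `a_n = #{𝔞 : N𝔞 = n}` and
`ρ_K = Res_{s=1} ζ_K`, `|∑_{1 ≤ n ≤ x} a_n/n − ρ_K log x| ≤ C_K` for `x ≥ 2`
(`∑_{0 < N𝔞 ≤ x} 1/N𝔞 = ρ_K log x + O_K(1)`), by partial summation from the Weber–Landau count
`I_K(t) = ρ_K t + O(t^{1−1/d})`. [cite: MontgomeryVaughan2007, (8.43) p. 266] [cite: HardyWright2008, §22.6 Theorem 424 (method)] -/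
theorem abs_sum_idealNormCount_div_sub_log_le :
    ∃ C : ℝ, ∀ x : ℝ, 2 ≤ x →
      |∑ n ∈ Icc 1 ⌊x⌋₊, (idealNormCount K n : ℝ) / n -
          NumberField.dedekindZeta_residue K * Real.log x| ≤ C := by
  set ρ : ℝ := NumberField.dedekindZeta_residue K with hρ
  have hρ0 : 0 < ρ := NumberField.dedekindZeta_residue_pos K
  set d : ℕ := Module.finrank ℚ K with hd
  have hd0 : 0 < d := Module.finrank_pos
  obtain ⟨C₀, hC₀⟩ := idealCount_sub_residue_mul_le_holds K
  -- the coefficients, with the unit ideal (and the junk value at `0`) removed, scaled by `1/ρ`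
  set c : ℕ → ℝ := fun n => if n ≤ 1 then 0 else (idealNormCount K n : ℝ) / ρ with hc
  have hc0 : c 0 = 0 := by simp [hc]
  have hc1 : c 1 = 0 := by simp [hc]
  -- summatory function: `(I_K(t) − 1)/ρ` for `t ≥ 1`
  have hS : ∀ t : ℝ, 1 ≤ t → ∑ n ∈ Icc 0 ⌊t⌋₊, c n = ((idealCount K t : ℝ) - 1) / ρ := by
    intro t ht
    have ht0 : 0 ≤ t := by linarith
    have h1t : 1 ≤ ⌊t⌋₊ := Nat.le_floor (by simpa using ht)
    rw [idealCount_eq_idealCount_floor K ht0, idealCount_natCast_eq_sum]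
    push_cast
    rw [eq_div_iff hρ0.ne', Finset.sum_mul]
    -- split off `n = 0, 1`
    have hsplit : Finset.Icc 0 ⌊t⌋₊ = insert 0 (Finset.Icc 1 ⌊t⌋₊) := by
      ext n; simp only [Finset.mem_insert, Finset.mem_Icc]; omega
    rw [hsplit, Finset.sum_insert (by simp), ← Finset.add_sum_erase _ _ (Finset.mem_Icc.2 ⟨le_rfl, h1t⟩),
      ← Finset.add_sum_erase (Finset.Icc 1 ⌊t⌋₊) _ (Finset.mem_Icc.2 ⟨le_rfl, h1t⟩)]
    simp only [hc, le_refl, zero_le, ite_true, zero_mul, zero_add]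
    rw [show (Nat.card {I : Ideal (𝓞 K) // Ideal.absNorm I = 1} : ℝ) = 1 by
      rw [← idealNormCount_def, idealNormCount_one]; simp]
    have : ∀ n ∈ (Finset.Icc 1 ⌊t⌋₊).erase 1, (if n ≤ 1 then 0 else (idealNormCount K n : ℝ) / ρ) * ρ =
        (Nat.card {I : Ideal (𝓞 K) // Ideal.absNorm I = n} : ℝ) := by
      intro n hn
      have hn2 : ¬ n ≤ 1 := by
        simp only [Finset.mem_erase, Finset.mem_Icc] at hn; omega
      rw [if_neg hn2, idealNormCount_def, div_mul_cancel₀ _ hρ0.ne']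
    rw [Finset.sum_congr rfl this]
    ring
  -- the Chebyshev-type hypothesis `|S(t) − t| ≤ C t/log² t`
  have hSbound : ∀ t : ℝ, 2 ≤ t →
      |∑ n ∈ Icc 0 ⌊t⌋₊, c n - t| ≤ ((|C₀| + 1) * (4 * (d : ℝ) ^ 2) / ρ) * t / Real.log t ^ 2 := by
    intro t ht
    have ht1 : 1 ≤ t := by linarith
    have ht0 : 0 < t := by linarith
    have hl : 0 < Real.log t := Real.log_pos (by linarith)
    rw [hS t ht1]
    have h1 := hC₀ t ht1
    have hkey : |((idealCount K t : ℝ) - 1) / ρ - t| ≤ (|C₀| + 1) * t ^ (1 - 1 / (d : ℝ)) / ρ := by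
      rw [show ((idealCount K t : ℝ) - 1) / ρ - t = ((idealCount K t : ℝ) - ρ * t - 1) / ρ by
        field_simp; ring]
      rw [abs_div, abs_of_pos hρ0, div_le_div_iff_of_pos_right hρ0]
      have hpow1 : (1 : ℝ) ≤ t ^ (1 - 1 / (d : ℝ)) := Real.one_le_rpow ht1 (by
        rw [sub_nonneg, div_le_one (by exact_mod_cast hd0 : (0 : ℝ) < d)]
        exact_mod_cast hd0)
      calc |(idealCount K t : ℝ) - ρ * t - 1| ≤ |(idealCount K t : ℝ) - ρ * t| + |(1 : ℝ)| :=
            abs_sub _ _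
        _ ≤ C₀ * t ^ (1 - 1 / (d : ℝ)) + 1 := by rw [abs_one]; exact add_le_add h1 le_rfl
        _ ≤ |C₀| * t ^ (1 - 1 / (d : ℝ)) + t ^ (1 - 1 / (d : ℝ)) :=
            add_le_add (mul_le_mul_of_nonneg_right (le_abs_self _) (by positivity)) hpow1
        _ = (|C₀| + 1) * t ^ (1 - 1 / (d : ℝ)) := by ring
    refine hkey.trans ?_
    rw [le_div_iff₀ (by positivity)]
    have h2 := rpow_one_sub_inv_mul_log_sq_le hd0 ht1
    calc (|C₀| + 1) * t ^ (1 - 1 / (d : ℝ)) / ρ * Real.log t ^ 2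
        = (|C₀| + 1) / ρ * (t ^ (1 - 1 / (d : ℝ)) * Real.log t ^ 2) := by ring
      _ ≤ (|C₀| + 1) / ρ * (4 * (d : ℝ) ^ 2 * t) :=
          mul_le_mul_of_nonneg_left h2 (by positivity)
      _ = (|C₀| + 1) * (4 * (d : ℝ) ^ 2) / ρ * t := by ring
  obtain ⟨C₁, hC₁⟩ := ThetaMertens.abs_sum_div_sub_log_le hc0 hc1
    (ThetaMertens.measurable_comp_natFloor fun m => ∑ n ∈ Icc 0 m, c n) hSbound
  refine ⟨ρ * C₁ + 1, fun x hx => ?_⟩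
  have hx1 : 1 ≤ ⌊x⌋₊ := Nat.le_floor (by simp; linarith)
  have h := hC₁ x hx
  -- `∑_{n ≤ x} c(n)/n = (∑_{1 ≤ n ≤ x} a_n/n − 1)/ρ`
  have hsum : ∑ n ∈ Icc 0 ⌊x⌋₊, c n / n =
      (∑ n ∈ Icc 1 ⌊x⌋₊, (idealNormCount K n : ℝ) / n - 1) / ρ := by
    have hsplit : Finset.Icc 0 ⌊x⌋₊ = insert 0 (Finset.Icc 1 ⌊x⌋₊) := by
      ext n; simp only [Finset.mem_insert, Finset.mem_Icc]; omega
    rw [hsplit, Finset.sum_insert (by simp), eq_div_iff hρ0.ne', add_mul, Finset.sum_mul,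
      ← Finset.add_sum_erase _ _ (Finset.mem_Icc.2 ⟨le_rfl, hx1⟩),
      ← Finset.add_sum_erase (Finset.Icc 1 ⌊x⌋₊) _ (Finset.mem_Icc.2 ⟨le_rfl, hx1⟩)]
    simp only [hc, le_refl, zero_le, ite_true, zero_div, zero_mul, zero_add, Nat.cast_one, div_one,
      idealNormCount_one, Nat.cast_zero]
    have : ∀ n ∈ (Finset.Icc 1 ⌊x⌋₊).erase 1,
        (if n ≤ 1 then 0 else (idealNormCount K n : ℝ) / ρ) / n * ρ = (idealNormCount K n : ℝ) / n := by
      intro n hn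
      have hn2 : ¬ n ≤ 1 := by
        simp only [Finset.mem_erase, Finset.mem_Icc] at hn; omega
      rw [if_neg hn2]
      field_simp
    rw [Finset.sum_congr rfl this]
    ring
  rw [hsum] at h
  have h' : |(∑ n ∈ Icc 1 ⌊x⌋₊, (idealNormCount K n : ℝ) / n - 1) - ρ * Real.log x| ≤ ρ * C₁ := by
    have heq : (∑ n ∈ Icc 1 ⌊x⌋₊, (idealNormCount K n : ℝ) / n - 1) - ρ * Real.log x =
        ρ * ((∑ n ∈ Icc 1 ⌊x⌋₊, (idealNormCount K n : ℝ) / n - 1) / ρ - Real.log x) := by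
      rw [mul_sub, mul_div_cancel₀ _ hρ0.ne']
    rw [heq, abs_mul, abs_of_pos hρ0]
    exact mul_le_mul_of_nonneg_left h hρ0.le
  calc |∑ n ∈ Icc 1 ⌊x⌋₊, (idealNormCount K n : ℝ) / n - ρ * Real.log x|
      = |((∑ n ∈ Icc 1 ⌊x⌋₊, (idealNormCount K n : ℝ) / n - 1) - ρ * Real.log x) + 1| := by ring_nf
    _ ≤ |(∑ n ∈ Icc 1 ⌊x⌋₊, (idealNormCount K n : ℝ) / n - 1) - ρ * Real.log x| + |(1 : ℝ)| :=
        abs_add_le _ _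
    _ ≤ ρ * C₁ + 1 := by rw [abs_one]; exact add_le_add h' le_rfl

end Literature.NumberTheory.LFunctions.NumberField
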